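/-
Copyright: cell `pub-balaban-gaps` (G2), seat ne6 (row NE7b), `prover-pub-balaban-gaps-ne6-g20-0`. Project licence.
-/
import Summits.QuantumFields.BalabanUV.T4Continuum.Spine.NE7b.CompactFibreMeanActionSUNDeriv
import Summits.QuantumFields.BalabanUV.T4Continuum.Spine.NE7b.CompactFibrePlaquetteMassSUNConstant
import Summits.QuantumFields.BalabanUV.T4Continuum.Spine.NE7b.CompactFibrePlaquetteMassSU2Limit

/-!
# THE INFORMATION COST OF TILTING ONE PLAQUETTE: `H_N(β) = −log Z_N(β) − β⟨s⟩_β ≥ 0` HAS DERIVATIVE `β·Var_β`, IS MINIMAL AT `β = 0`, AND GROWS LIKE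
# `((N²−1)∕2)·log β` AT WEAK COUPLING (row NE7b, node U5c; MODEL, [folklore]; census V59)

Cell `pub-balaban-gaps` (G2 spine census) for the `pub-balaban` T⁴ crux NE7b (`T4WeightBudget.RelWeightBound`; NOT PRINTED, NOT PROVED).  Crux-route work under
`Spine/NE7b/`; imports the landed V56 `CompactFibreMeanActionSUNDeriv` (`hasDerivAt_meanAction_SUN`, `actionVariance_SUN_nonneg`; it re-exports V50's
`hasDerivAt_freeEnergy_SUN`) and J4 `CompactFibrePlaquetteMassSUNConstant` (`tendsto_mul_meanAction_SUN`, `exists_tendsto_freeEnergy_constant_SUN` — every `N`,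
unconditional; it re-exports V49's `tendsto_mul_meanAction_SU2`) and V45 `CompactFibrePlaquetteMassSU2Limit` (`tendsto_freeEnergy_constant_SU2`) + Mathlib (`monotoneOn_of_deriv_nonneg`,
`antitoneOn_of_deriv_nonpos`); no `def`, zero `sorry`, nothing of Bałaban's asserted.

THE LOCATED QUESTION.  For the tilted one-plaquette state `dμ_β = e^{−βs}dHaar∕Z_N(β)` (`s = Re tr(1−V)`) the relative entropy with respect to Haar is, by the Gibbs
formula, `D(μ_β‖Haar) = ∫ log(dμ_β∕dHaar) dμ_β = −β⟨s⟩_β − log Z_N(β)`.  V49 proved `β⟨s⟩_β ≤ −log Z_N(β)` for `β ≥ 0` (tangent-line Jensen), i.e. `D ≥ 0` there.  QUESTION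
(V59): the WHOLE profile of `H_N(β) := −log Z_N(β) − β⟨s⟩_β` (stated long-hand; no measure `μ_β` is constructed — the entropy reading is the docstrings' only).
ANSWER ([folklore], every `N`, every real `β`):
* §1 **`hasDerivAt_tiltEntropy_SUN`**: `H_N′(β) = β·Var_β(s)` (V50's `(−log Z_N)′ = ⟨s⟩` and V56's `⟨s⟩′ = −Var` with the product rule); **`tiltEntropy_SUN_zero`** (`H_N(0) = 0`);
* §2 **`tiltEntropy_SUN_monotoneOn`** (non-decreasing on `[0, ∞)`), **`tiltEntropy_SUN_antitoneOn`** (non-increasing on `(−∞, 0]`), **`tiltEntropy_SUN_nonneg`**: `0 ≤ H_N(β)`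
  for EVERY REAL `β` (V49's inequality extended to `β < 0` without a correlation inequality: the minimum is at `β = 0`);
* §3 WEAK COUPLING: **`exists_tendsto_tiltEntropy_sub_log_SUN`**: `∃ c, H_N(β) − ((N²−1)∕2)·log β → c` (J4: equipartition `β⟨s⟩_β → (N²−1)∕2` and the free-energy
  constant), and for `SU(2)` explicitly **`tendsto_tiltEntropy_sub_log_SU2`**: `H(β) − (3∕2)·log β → log(2√π) − 3∕2` — concentrating the plaquette costs `(dim SU(N)∕2)·log β +
  O(1)` nats of information relative to Haar.

HONEST REMARKS.  (i) MODEL ∕ [folklore]: Haar calculus of ONE `SU(N)` plaquette variable, NOT the interacting measure; `H_N` is a real function here — its identification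
with a relative entropy is standard (Gibbs variational formula) but NOT formalised in this file.  (ii) No rate in §3 beyond the limit.  (iii) (A3) ∕ (A1c) NOT asserted;
NC-NE7b-α UNRULED.  BY-NAME EFFECT ON THE WALL: NONE.  NE7b NOT PRINTED ∕ NOT PROVED; spine PROVED 0∕9; rung (B)+1 on ONE finite T⁴ — NOT infinite volume, NOT the
mass gap, NOT Clay.
HONEST DEPENDENCY: continuum YM on T⁴ ⇐ BetaPertH ∧ nine spine estimates (0/9 proved); BetaPertH ⇐ (D1) ∧ (D4) ∧ CAP+tail;
G-an2-4 gates asym, D1 and NE2/3/4.  This file changes none of it.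
-/

set_option autoImplicit false

noncomputable section

open Real Set MeasureTheory Filter Topology
open Literature.MathematicalPhysics.QuantumFieldTheory (haarProbability)
open Summit.QuantumFields.BalabanUV.T4Continuum.NE7b.CompactFibreMeanActionSUNMonotone (hasDerivAt_freeEnergy_SUN)
open Summit.QuantumFields.BalabanUV.T4Continuum.NE7b.CompactFibreMeanActionSUNDeriv (hasDerivAt_meanAction_SUN actionVariance_SUN_nonneg)
open Summit.QuantumFields.BalabanUV.T4Continuum.NE7b.CompactFibrePlaquetteMassSUNConstant (tendsto_mul_meanAction_SUN exists_tendsto_freeEnergy_constant_SUN)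
open Summit.QuantumFields.BalabanUV.T4Continuum.NE7b.CompactFibreMeanActionSUNLimit (tendsto_mul_meanAction_SU2)
open Summit.QuantumFields.BalabanUV.T4Continuum.NE7b.CompactFibrePlaquetteMassSU2Limit (tendsto_freeEnergy_constant_SU2)

namespace Summit.QuantumFields.BalabanUV.T4Continuum.NE7b.CompactFibreTiltEntropySUN

variable {N : ℕ}

/-! ### §1 The derivative of `H_N(β) = −log Z_N(β) − β⟨s⟩_β` -/

/-- **`H_N′(β) = β·Var_β(Re tr(1−V))`**, every `N`, every real `β`: with `F = −log Z_N`, `F′ = ⟨s⟩` (V50) and `⟨s⟩′ = −Var` (V56), the product rule gives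
`(F − β⟨s⟩)′ = ⟨s⟩ − ⟨s⟩ + β·Var = β·Var`. [folklore] -/
theorem hasDerivAt_tiltEntropy_SUN (β : ℝ) :
    HasDerivAt (fun b : ℝ =>
        -Real.log (∫ V, Real.exp (-(b * (Matrix.trace (1 - (V : Matrix (Fin N) (Fin N) ℂ))).re)) ∂(haarProbability (Matrix.specialUnitaryGroup (Fin N) ℂ)))
          - b * ((∫ V, (Matrix.trace (1 - (V : Matrix (Fin N) (Fin N) ℂ))).re * Real.exp (-(b * (Matrix.trace (1 - (V : Matrix (Fin N) (Fin N) ℂ))).re))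
                ∂(haarProbability (Matrix.specialUnitaryGroup (Fin N) ℂ)))
              / ∫ V, Real.exp (-(b * (Matrix.trace (1 - (V : Matrix (Fin N) (Fin N) ℂ))).re)) ∂(haarProbability (Matrix.specialUnitaryGroup (Fin N) ℂ))))
      (β * ((∫ V, (Matrix.trace (1 - (V : Matrix (Fin N) (Fin N) ℂ))).re ^ 2 * Real.exp (-(β * (Matrix.trace (1 - (V : Matrix (Fin N) (Fin N) ℂ))).re))
                ∂(haarProbability (Matrix.specialUnitaryGroup (Fin N) ℂ)))
              / (∫ V, Real.exp (-(β * (Matrix.trace (1 - (V : Matrix (Fin N) (Fin N) ℂ))).re)) ∂(haarProbability (Matrix.specialUnitaryGroup (Fin N) ℂ)))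
            - ((∫ V, (Matrix.trace (1 - (V : Matrix (Fin N) (Fin N) ℂ))).re * Real.exp (-(β * (Matrix.trace (1 - (V : Matrix (Fin N) (Fin N) ℂ))).re))
                  ∂(haarProbability (Matrix.specialUnitaryGroup (Fin N) ℂ)))
                / ∫ V, Real.exp (-(β * (Matrix.trace (1 - (V : Matrix (Fin N) (Fin N) ℂ))).re)) ∂(haarProbability (Matrix.specialUnitaryGroup (Fin N) ℂ))) ^ 2)) β := by
  have hF := hasDerivAt_freeEnergy_SUN (N := N) β
  have hm := hasDerivAt_meanAction_SUN (N := N) β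
  have hbm := (hasDerivAt_id β).mul hm
  have h := hF.sub hbm
  refine h.congr_deriv ?_
  simp only [id]
  ring

/-- **`H_N(0) = 0`** (`Z_N(0) = 1`). [folklore] -/
theorem tiltEntropy_SUN_zero :
    -Real.log (∫ V, Real.exp (-((0 : ℝ) * (Matrix.trace (1 - (V : Matrix (Fin N) (Fin N) ℂ))).re)) ∂(haarProbability (Matrix.specialUnitaryGroup (Fin N) ℂ)))
        - (0 : ℝ) * ((∫ V, (Matrix.trace (1 - (V : Matrix (Fin N) (Fin N) ℂ))).re * Real.exp (-((0 : ℝ) * (Matrix.trace (1 - (V : Matrix (Fin N) (Fin N) ℂ))).re))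
              ∂(haarProbability (Matrix.specialUnitaryGroup (Fin N) ℂ)))
            / ∫ V, Real.exp (-((0 : ℝ) * (Matrix.trace (1 - (V : Matrix (Fin N) (Fin N) ℂ))).re)) ∂(haarProbability (Matrix.specialUnitaryGroup (Fin N) ℂ))) = 0 := by
  simp only [zero_mul, neg_zero, Real.exp_zero, integral_const, probReal_univ, one_smul, Real.log_one, sub_zero]

/-! ### §2 Monotonicity on each side of `0`; nonnegativity on all of ℝ -/

/-- **`H_N` IS NON-DECREASING ON `[0, ∞)`** (`H′ = β·Var_β ≥ 0` there). [folklore] -/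
theorem tiltEntropy_SUN_monotoneOn :
    MonotoneOn (fun b : ℝ =>
        -Real.log (∫ V, Real.exp (-(b * (Matrix.trace (1 - (V : Matrix (Fin N) (Fin N) ℂ))).re)) ∂(haarProbability (Matrix.specialUnitaryGroup (Fin N) ℂ)))
          - b * ((∫ V, (Matrix.trace (1 - (V : Matrix (Fin N) (Fin N) ℂ))).re * Real.exp (-(b * (Matrix.trace (1 - (V : Matrix (Fin N) (Fin N) ℂ))).re))
                ∂(haarProbability (Matrix.specialUnitaryGroup (Fin N) ℂ)))
              / ∫ V, Real.exp (-(b * (Matrix.trace (1 - (V : Matrix (Fin N) (Fin N) ℂ))).re)) ∂(haarProbability (Matrix.specialUnitaryGroup (Fin N) ℂ))))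
      (Set.Ici 0) := by
  have hd := fun b : ℝ => hasDerivAt_tiltEntropy_SUN (N := N) b
  refine monotoneOn_of_deriv_nonneg (convex_Ici 0) (fun b _ => (hd b).continuousAt.continuousWithinAt)
    (fun b _ => (hd b).differentiableAt.differentiableWithinAt) fun b hb => ?_
  rw [interior_Ici] at hb
  rw [(hd b).deriv]
  exact mul_nonneg (le_of_lt hb) (actionVariance_SUN_nonneg (N := N) b)

/-- **`H_N` IS NON-INCREASING ON `(−∞, 0]`** (`H′ = β·Var_β ≤ 0` there). [folklore] -/
theorem tiltEntropy_SUN_antitoneOn :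
    AntitoneOn (fun b : ℝ =>
        -Real.log (∫ V, Real.exp (-(b * (Matrix.trace (1 - (V : Matrix (Fin N) (Fin N) ℂ))).re)) ∂(haarProbability (Matrix.specialUnitaryGroup (Fin N) ℂ)))
          - b * ((∫ V, (Matrix.trace (1 - (V : Matrix (Fin N) (Fin N) ℂ))).re * Real.exp (-(b * (Matrix.trace (1 - (V : Matrix (Fin N) (Fin N) ℂ))).re))
                ∂(haarProbability (Matrix.specialUnitaryGroup (Fin N) ℂ)))
              / ∫ V, Real.exp (-(b * (Matrix.trace (1 - (V : Matrix (Fin N) (Fin N) ℂ))).re)) ∂(haarProbability (Matrix.specialUnitaryGroup (Fin N) ℂ))))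
      (Set.Iic 0) := by
  have hd := fun b : ℝ => hasDerivAt_tiltEntropy_SUN (N := N) b
  refine antitoneOn_of_deriv_nonpos (convex_Iic 0) (fun b _ => (hd b).continuousAt.continuousWithinAt)
    (fun b _ => (hd b).differentiableAt.differentiableWithinAt) fun b hb => ?_
  rw [interior_Iic] at hb
  rw [(hd b).deriv]
  exact mul_nonpos_of_nonpos_of_nonneg (le_of_lt hb) (actionVariance_SUN_nonneg (N := N) b)

/-- **`0 ≤ H_N(β) = −log Z_N(β) − β⟨s⟩_β` FOR EVERY REAL `β`, EVERY `N`** (minimum `H_N(0) = 0`; V49's `mul_meanAction_le_freeEnergy` had `β ≥ 0`): the Gibbs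
inequality `β⟨s⟩_β ≤ −log Z_N(β)` on all of ℝ. [folklore] -/
theorem tiltEntropy_SUN_nonneg (β : ℝ) :
    0 ≤ -Real.log (∫ V, Real.exp (-(β * (Matrix.trace (1 - (V : Matrix (Fin N) (Fin N) ℂ))).re)) ∂(haarProbability (Matrix.specialUnitaryGroup (Fin N) ℂ)))
          - β * ((∫ V, (Matrix.trace (1 - (V : Matrix (Fin N) (Fin N) ℂ))).re * Real.exp (-(β * (Matrix.trace (1 - (V : Matrix (Fin N) (Fin N) ℂ))).re))
                ∂(haarProbability (Matrix.specialUnitaryGroup (Fin N) ℂ)))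
              / ∫ V, Real.exp (-(β * (Matrix.trace (1 - (V : Matrix (Fin N) (Fin N) ℂ))).re)) ∂(haarProbability (Matrix.specialUnitaryGroup (Fin N) ℂ))) := by
  have h0 := tiltEntropy_SUN_zero (N := N)
  rcases le_total 0 β with hβ | hβ
  · have h := tiltEntropy_SUN_monotoneOn (N := N) (Set.mem_Ici.2 le_rfl) (Set.mem_Ici.2 hβ) hβ
    simp only at h
    rw [h0] at h
    exact h
  · have h := tiltEntropy_SUN_antitoneOn (N := N) (Set.mem_Iic.2 hβ) (Set.mem_Iic.2 le_rfl) hβ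
    simp only at h
    rw [h0] at h
    exact h

/-! ### §3 Weak coupling: the entropy of concentration -/

/-- **`∃ c, H_N(β) − ((N²−1)∕2)·log β → c` AS `β → ∞`, EVERY `N`** (J4: `β⟨s⟩_β → (N²−1)∕2` and `−log Z_N(β) − ((N²−1)∕2)log β → c₁`; `c = c₁ − (N²−1)∕2`):
concentrating one plaquette costs `(dim SU(N)∕2)·log β + O(1)` relative to Haar. [folklore] -/
theorem exists_tendsto_tiltEntropy_sub_log_SUN :
    ∃ c : ℝ, Tendsto (fun β : ℝ =>
        -Real.log (∫ V, Real.exp (-(β * (Matrix.trace (1 - (V : Matrix (Fin N) (Fin N) ℂ))).re)) ∂(haarProbability (Matrix.specialUnitaryGroup (Fin N) ℂ)))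
          - β * ((∫ V, (Matrix.trace (1 - (V : Matrix (Fin N) (Fin N) ℂ))).re * Real.exp (-(β * (Matrix.trace (1 - (V : Matrix (Fin N) (Fin N) ℂ))).re))
                ∂(haarProbability (Matrix.specialUnitaryGroup (Fin N) ℂ)))
              / ∫ V, Real.exp (-(β * (Matrix.trace (1 - (V : Matrix (Fin N) (Fin N) ℂ))).re)) ∂(haarProbability (Matrix.specialUnitaryGroup (Fin N) ℂ)))
          - ((N ^ 2 - 1 : ℕ) : ℝ) / 2 * Real.log β)
      atTop (𝓝 c) := by
  obtain ⟨c₁, hc₁⟩ := exists_tendsto_freeEnergy_constant_SUN (N := N)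
  refine ⟨c₁ - ((N ^ 2 - 1 : ℕ) : ℝ) / 2, ?_⟩
  have h := hc₁.sub (tendsto_mul_meanAction_SUN (N := N))
  refine h.congr fun β => ?_
  ring

/-- **`SU(2)`: `H(β) − (3∕2)·log β → log(2√π) − 3∕2`** (V45's free-energy constant `log(2√π)` and V49's `β⟨s⟩_β → 3∕2`). [folklore] -/
theorem tendsto_tiltEntropy_sub_log_SU2 :
    Tendsto (fun β : ℝ =>
        -Real.log (∫ U, Real.exp (-(β * (Matrix.trace (1 - (U : Matrix (Fin 2) (Fin 2) ℂ))).re)) ∂(haarProbability (Matrix.specialUnitaryGroup (Fin 2) ℂ)))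
          - β * ((∫ U, (Matrix.trace (1 - (U : Matrix (Fin 2) (Fin 2) ℂ))).re * Real.exp (-(β * (Matrix.trace (1 - (U : Matrix (Fin 2) (Fin 2) ℂ))).re))
                ∂(haarProbability (Matrix.specialUnitaryGroup (Fin 2) ℂ)))
              / ∫ U, Real.exp (-(β * (Matrix.trace (1 - (U : Matrix (Fin 2) (Fin 2) ℂ))).re)) ∂(haarProbability (Matrix.specialUnitaryGroup (Fin 2) ℂ)))
          - 3 / 2 * Real.log β)
      atTop (𝓝 (Real.log (2 * Real.sqrt Real.pi) - 3 / 2)) := by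
  have h := tendsto_freeEnergy_constant_SU2.sub tendsto_mul_meanAction_SU2
  refine h.congr fun β => ?_
  ring

end Summit.QuantumFields.BalabanUV.T4Continuum.NE7b.CompactFibreTiltEntropySUN

end
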